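import Literature.NumberTheory.EllipticCurves.Shintani32KernelPoisson
import Literature.NumberTheory.EllipticCurves.ShintaniKernelOdd
import HarnessLib

/-!
# The level-`128` transformation law of the kernels `K₃₂,D` (trivial character)

[[cite: Shintani1975, §1 Prop. 1.6]] — for `D` odd and square-free, the twisted Shintani theta
kernel `K₃₂,D(w, z) = 𝒦₃₂[c_D, 1/(128D)](w, z)` of `Shintani32Kernel` (lattice
`L♮₃₂ = {[32a, b, c]}`, weight the genus character of `-8D`) is, as a function of `z`,
`θ`-automorphic of weight `3/2` on `Γ₀(128)` with **trivial** character
(`isThetaAutomorphic_kerD32`): `K₃₂,D(w, γz) = (θ(γz)/θ(z))³ K₃₂,D(w, z)` for `γ ∈ Γ₀(128)`.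
This is the kernel that lifts the level-`32` congruent-number newform into Tunnell's space
`S_{3/2}(128, 1)` (route to Waldspurger's corollary at level `128` and
`Literature.NumberTheory.EllipticCurves.Tunnell1983_a_sq_propto_L_one`), for BOTH residues of
`D` modulo `4` — in contrast with the level-`256` kernels of the tree
(`ShintaniKernelLevel256Law`, `ShintaniKernelOdd`).

Proof: `Γ₀(128)` is generated by `T`, `-1` and the `σ = (a b; 128 d)`
(`gamma0_le_closure_genSet 7`); the `T`-law is `kerD32_T_smul`, `-1` acts trivially, and for
`σ` the Poisson step at `c = 128` (`Shintani32KernelPoisson.kerD32_smul_sigma`) produces the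
constant `(Im σz)^{1/2} (2048N³)⁻¹ κ(Z') (64N)⁻¹ 𝒦₃₂(a,a*) (Im z)^{-1/2}`, `N = 128D`, which is
identified with the cube of the `θ`-multiplier `G(a;128) (2i·128/(128z+d))^{-1/2}`
(`const_identity32`): the analytic part is `κ(Z') · 8√2 β = -(128N)² √(128N) w₁ |w₁|²`
(`w₁ = 128z + d`, `β = (i w̄₁)^{1/2}`), the arithmetic part the `z`-free identity
`4096 √2 √D · 𝒦₃₂(a,a*) = i G(a;128)³ N²` (`evalConst32_key`), checked on the eight classes
`(D mod 4, a mod 8)` from `G(a;128) = 8√2 χ₈(a)(1 + ψ₄(a))`,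
`G(32a;128D) = 64 (1 + ψ₄(Da)) (a/D) G(1;D)` and Gauss's sign of `G(1; D)`.

No new facts; definitions `w128`, `rZ128`, `genSet32D`.
-/

noncomputable section

open Complex Real
open scoped MatrixGroups ComplexConjugate

namespace Literature.NumberTheory.EllipticCurves.Shintani

open UpperHalfPlane hiding I
open Literature.NumberTheory.EllipticCurves.ModularForms
open Literature.NumberTheory.EllipticCurves.Tunnell1983 (thetaMul_one_eq_shimuraTheta thetaMul_one_smul)

/-! ### Gauss-sum evaluations at `128` -/

/-- `G(a; 128) = 8√2 χ₈(a) (1 + ψ₄(a))` for odd `a`. [folklore] -/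
theorem quadGaussSum_128_of_odd {a : ℤ} (ha : Odd a) :
    quadGaussSum 128 a 0 = 8 * (Real.sqrt 2 : ℂ) * ZMod.χ₈ a * (1 + (ZMod.stdAddChar (a : ZMod 4) : ℂ)) := by
  haveI : NeZero (64 : ℕ) := ⟨by norm_num⟩
  haveI : NeZero (16 : ℕ) := ⟨by norm_num⟩
  have hgcd : a.gcd 128 = 1 := by
    have h2 : IsCoprime a 2 := by
      obtain ⟨k, hk⟩ := ha
      exact ⟨1, -k, by rw [hk]; ring⟩
    have h128 : IsCoprime a ((2 : ℤ) ^ 7) := h2.pow_right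
    norm_num at h128
    exact Int.isCoprime_iff_gcd_eq_one.mp h128
  have h1 : quadGaussSum 128 a 0 = Real.sqrt 2 * ZMod.χ₈ a * quadGaussSum 64 a 0 :=
    quadGaussSum_two_mul (by norm_num) (by norm_num) hgcd
  have h2 : quadGaussSum 64 a 0 = 2 * quadGaussSum 16 a 0 :=
    quadGaussSum_four_mul' (by norm_num) (by norm_num) ha
  have h3 : quadGaussSum 16 a 0 = 2 * quadGaussSum 4 a 0 :=
    quadGaussSum_four_mul' (by norm_num) (by norm_num) ha
  rw [h1, h2, h3, quadGaussSum_four_eq]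
  ring

/-- `G(32a; 128D) = 64 (1 + ψ₄(Da)) (a/D) G(1; D)` for `D` odd and `gcd(a, D) = 1`. [folklore] -/
theorem quadGaussSum_32_mul (D : ℕ) [NeZero D] (hodd : Odd D) {a : ℤ} (haD : a.gcd D = 1) :
    quadGaussSum (128 * D) (32 * (a : ZMod (128 * D))) 0 =
      64 * (1 + (ZMod.stdAddChar (((D : ℤ) * a : ℤ) : ZMod 4) : ℂ)) * jacobiSym a D *
        quadGaussSum D 1 0 := by
  have h2D : Nat.Coprime 2 D := Nat.coprime_two_left.mpr hodd
  have hcop : Nat.Coprime 4 D := by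
    have := Nat.Coprime.pow_left 2 h2D
    norm_num at this
    exact this
  haveI : NeZero (4 * D) := ⟨mul_ne_zero (by norm_num) (NeZero.ne D)⟩
  have e0 : (32 * (a : ZMod (128 * D))) = ((((32 : ℕ) : ℤ) * a : ℤ) : ZMod (128 * D)) := by push_cast; ring
  rw [e0, quadGaussSum_mul_mul (c := 128 * D) (t := 32) (m := 4 * D) (by ring) a,
    quadGaussSum_mul_of_coprime hcop a]
  have f1 : quadGaussSum 4 (((D : ℤ) * a : ℤ) : ZMod 4) 0 =
      2 * (1 + (ZMod.stdAddChar (((D : ℤ) * a : ℤ) : ZMod 4) : ℂ)) := by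
    rw [quadGaussSum_four_eq]; ring
  have f2 : quadGaussSum D ((((4 : ℕ) : ℤ) * a : ℤ) : ZMod D) 0 = jacobiSym a D * quadGaussSum D 1 0 := by
    have hu : IsUnit ((2 : ℕ) : ZMod D) := by
      rw [ZMod.isUnit_iff_coprime]; exact h2D
    have : ((((4 : ℕ) : ℤ) * a : ℤ) : ZMod D) = ((2 : ℕ) : ZMod D) ^ 2 * (a : ZMod D) := by
      push_cast; ring
    rw [this, quadGaussSum_unit_sq_mul hu, quadGaussSum_eq_jacobiSym_mul hodd haD]
  rw [f1, f2]
  push_cast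
  ring

/-! ### The constants at `σ = (a b; 128 d)` -/

section Constants

variable (D : ℕ) [NeZero D]

/-- `w₁ = 128 z + d`. [folklore] -/
def w128 (d : ℤ) (z : ℍ) : ℂ := 128 * (z : ℂ) + d

/-- `r = 128 N |w₁|²`, `N = 128 D`. [folklore] -/
def rZ128 (d : ℤ) (z : ℍ) : ℝ := 128 * (128 * D : ℕ) * Complex.normSq (w128 d z)

omit [NeZero D] in
/-- `w₁` has positive imaginary part. [folklore] -/
theorem im_w128_pos (d : ℤ) (z : ℍ) : 0 < (w128 d z).im := by
  have : (w128 d z).im = 128 * z.im := by simp [w128]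
  rw [this]; exact mul_pos (by norm_num) z.im_pos

omit [NeZero D] in
/-- `w₁ ≠ 0`. [folklore] -/
theorem w128_ne_zero (d : ℤ) (z : ℍ) : w128 d z ≠ 0 := fun h ↦ by
  have := im_w128_pos d z; rw [h] at this; simp at this

/-- `r > 0`. [folklore] -/
theorem rZ128_pos (d : ℤ) (z : ℍ) : 0 < rZ128 D d z := by
  unfold rZ128
  have h1 : (0 : ℝ) < (128 * D : ℕ) := by exact_mod_cast Nat.pos_of_ne_zero (NeZero.ne _)
  have h2 := Complex.normSq_pos.mpr (w128_ne_zero d z)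
  positivity

/-- The point `Z' = -1/(128 N w₁)`. [folklore] -/
theorem coe_Z'128 (d : ℤ) (z : ℍ) :
    ((invFour (auxW32 (128 * D) 128 d z) : ℍ) : ℂ) = -1 / (128 * (128 * D : ℕ) * w128 d z) := by
  rw [coe_invFour_auxW32, w128]; push_cast; ring

/-- `a_S(Z') = (4/r)(-i w₁)`. [folklore] -/
theorem aS_Z'128 (d : ℤ) (z : ℍ) :
    aS (invFour (auxW32 (128 * D) 128 d z)) = ((4 / rZ128 D d z : ℝ) : ℂ) * (-I * w128 d z) := by
  have hw0 := w128_ne_zero d z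
  have hcw0 : conj (w128 d z) ≠ 0 := (map_ne_zero _).mpr hw0
  have hN0 : ((128 * D : ℕ) : ℂ) ≠ 0 := by exact_mod_cast NeZero.ne (128 * D)
  have hnsq : ((Complex.normSq (w128 d z) : ℝ) : ℂ) = w128 d z * conj (w128 d z) :=
    (Complex.mul_conj (w128 d z)).symm
  have hconj : conj (-1 / (128 * ((128 * D : ℕ) : ℂ) * w128 d z)) =
      -1 / (128 * ((128 * D : ℕ) : ℂ) * conj (w128 d z)) := by
    rw [map_div₀, map_mul, map_mul, map_neg, map_one, map_natCast, map_ofNat]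
  rw [aS, coe_Z'128, hconj, rZ128]
  push_cast
  rw [hnsq]
  field_simp

/-- `a_B(Z') = (2/r)(i w̄₁)`. [folklore] -/
theorem aB_Z'128 (d : ℤ) (z : ℍ) :
    aB (invFour (auxW32 (128 * D) 128 d z)) = ((2 / rZ128 D d z : ℝ) : ℂ) * (I * conj (w128 d z)) := by
  have hw0 := w128_ne_zero d z
  have hcw0 : conj (w128 d z) ≠ 0 := (map_ne_zero _).mpr hw0
  have hN0 : ((128 * D : ℕ) : ℂ) ≠ 0 := by exact_mod_cast NeZero.ne (128 * D)
  have hnsq : ((Complex.normSq (w128 d z) : ℝ) : ℂ) = w128 d z * conj (w128 d z) :=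
    (Complex.mul_conj (w128 d z)).symm
  rw [aB, coe_Z'128, rZ128]
  push_cast
  rw [hnsq]
  field_simp

/-- `a_T(Z') = (4/r)(i w̄₁)`. [folklore] -/
theorem aT_Z'128 (d : ℤ) (z : ℍ) :
    aT (invFour (auxW32 (128 * D) 128 d z)) = ((4 / rZ128 D d z : ℝ) : ℂ) * (I * conj (w128 d z)) := by
  have hw0 := w128_ne_zero d z
  have hcw0 : conj (w128 d z) ≠ 0 := (map_ne_zero _).mpr hw0
  have hN0 : ((128 * D : ℕ) : ℂ) ≠ 0 := by exact_mod_cast NeZero.ne (128 * D)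
  have hnsq : ((Complex.normSq (w128 d z) : ℝ) : ℂ) = w128 d z * conj (w128 d z) :=
    (Complex.mul_conj (w128 d z)).symm
  rw [aT, coe_Z'128, rZ128]
  push_cast
  rw [hnsq]
  field_simp

/-- `1/(2Z') = -128 N w₁/2`. [folklore] -/
theorem one_div_two_Z'128 (d : ℤ) (z : ℍ) :
    1 / (2 * ((invFour (auxW32 (128 * D) 128 d z) : ℍ) : ℂ)) = -(128 * (128 * D : ℕ) * w128 d z) / 2 := by
  have hw0 := w128_ne_zero d z
  have hN0 : ((128 * D : ℕ) : ℂ) ≠ 0 := by exact_mod_cast NeZero.ne (128 * D)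
  rw [coe_Z'128]
  field_simp

omit [NeZero D] in
/-- `β = (i w̄₁)^{1/2} ≠ 0`. [folklore] -/
theorem beta128_ne_zero (d : ℤ) (z : ℍ) : (I * conj (w128 d z)) ^ (1 / 2 : ℂ) ≠ 0 := by
  rw [Ne, Complex.cpow_eq_zero_iff, not_and_or]
  left
  exact mul_ne_zero I_ne_zero ((map_ne_zero _).mpr (w128_ne_zero d z))

omit [NeZero D] in
/-- `ρ² = -i w₁ β²`. [folklore] -/
theorem rho128_sq_eq (d : ℤ) (z : ℍ) :
    ((Real.sqrt (Complex.normSq (w128 d z)) : ℂ)) ^ 2 =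
      -I * w128 d z * ((I * conj (w128 d z)) ^ (1 / 2 : ℂ)) ^ 2 := by
  rw [← cpow_half_mul_cpow_half_conj (im_w128_pos d z), mul_pow, cpow_half_sq]

/-- **`κ(Z')`**: `κ(Z') · 8√2 β = -(128N)² √(128N) w₁ |w₁|²`. [folklore] -/
theorem kappa_Z'128_mul (d : ℤ) (z : ℍ) :
    kappa (invFour (auxW32 (128 * D) 128 d z)) *
        (8 * (Real.sqrt 2 : ℂ) * (I * conj (w128 d z)) ^ (1 / 2 : ℂ)) =
      -(((128 * (128 * D : ℕ) : ℝ) : ℂ)) ^ 2 * (Real.sqrt (128 * (128 * D : ℕ)) : ℂ) * w128 d z *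
        (Complex.normSq (w128 d z) : ℂ) := by
  have hr := rZ128_pos D d z
  set ρ : ℝ := Real.sqrt (Complex.normSq (w128 d z)) with hρ
  set sM : ℝ := Real.sqrt (128 * (128 * D : ℕ)) with hsM
  have hρ0 : 0 < ρ := Real.sqrt_pos.mpr (Complex.normSq_pos.mpr (w128_ne_zero d z))
  have hM0 : (0 : ℝ) < 128 * (128 * D : ℕ) := by
    have : (0 : ℝ) < (128 * D : ℕ) := by exact_mod_cast Nat.pos_of_ne_zero (NeZero.ne _)
    positivity
  have hsM0 : 0 < sM := Real.sqrt_pos.mpr hM0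
  have hsr : Real.sqrt (rZ128 D d z) = sM * ρ := by
    rw [rZ128]; exact Real.sqrt_mul hM0.le _
  have hs4 : Real.sqrt 4 = 2 := by
    rw [show (4 : ℝ) = 2 ^ 2 by norm_num]; exact Real.sqrt_sq (by norm_num)
  have h4 : Real.sqrt (4 / rZ128 D d z) = 2 / (sM * ρ) := by
    rw [Real.sqrt_div' _ hr.le, hs4, hsr]
  have h2 : Real.sqrt (2 / rZ128 D d z) = Real.sqrt 2 / (sM * ρ) := by
    rw [Real.sqrt_div' _ hr.le, hsr]
  have hαβ := cpow_half_mul_cpow_half_conj (im_w128_pos d z)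
  have hβ := beta128_ne_zero d z
  set β : ℂ := (I * conj (w128 d z)) ^ (1 / 2 : ℂ) with hβdef
  set α : ℂ := (-I * w128 d z) ^ (1 / 2 : ℂ) with hαdef
  have hα : α = (ρ : ℂ) / β := by rw [eq_div_iff hβ]; exact hαβ
  have hs2 : (Real.sqrt 2 : ℂ) ≠ 0 := by
    exact_mod_cast (Real.sqrt_pos.mpr (by norm_num : (0:ℝ) < 2)).ne'
  have hnsq : ((Complex.normSq (w128 d z) : ℝ) : ℂ) = (ρ : ℂ) ^ 2 := by
    rw [hρ]; exact_mod_cast (Real.sq_sqrt (Complex.normSq_nonneg _)).symm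
  have hρ0' : (ρ : ℂ) ≠ 0 := by exact_mod_cast hρ0.ne'
  have hsM0' : (sM : ℂ) ≠ 0 := by exact_mod_cast hsM0.ne'
  have hsMsq : ((sM : ℂ)) ^ 2 = 128 * (128 * (D : ℂ)) := by
    rw [hsM]; exact_mod_cast Real.sq_sqrt hM0.le
  unfold kappa
  rw [one_div_two_Z'128, aS_Z'128, aB_Z'128, aT_Z'128, cpow_half_ofReal_mul (by positivity),
    cpow_half_ofReal_mul (by positivity), cpow_half_ofReal_mul (by positivity), h4, h2,
    ← hαdef, ← hβdef, hα, hnsq]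
  push_cast
  field_simp
  linear_combination (-(D : ℂ) * w128 d z * 8) * hsMsq

omit [NeZero D] in
/-- **The `θ`-side factor at `c = 128`**: `(2i·128/(128z+d))^{-1/2} = |w₁| / (16 β)`. [folklore] -/
theorem thetaFactor_sigma128 (d : ℤ) (z : ℍ) :
    1 / (2 * I * ((128 : ℕ) : ℂ) / (((128 : ℕ) : ℂ) * z + d)) ^ (1 / 2 : ℂ) =
      (Real.sqrt (Complex.normSq (w128 d z)) : ℂ) / (16 * (I * conj (w128 d z)) ^ (1 / 2 : ℂ)) := by
  have hw0 := w128_ne_zero d z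
  have hcw0 : conj (w128 d z) ≠ 0 := (map_ne_zero _).mpr hw0
  have hn0 : (0 : ℝ) < Complex.normSq (w128 d z) := Complex.normSq_pos.mpr hw0
  have hβ := beta128_ne_zero d z
  have key : 2 * I * ((128 : ℕ) : ℂ) / (((128 : ℕ) : ℂ) * z + d) =
      ((256 / Complex.normSq (w128 d z) : ℝ) : ℂ) * (I * conj (w128 d z)) := by
    have hnsq : ((Complex.normSq (w128 d z) : ℝ) : ℂ) = w128 d z * conj (w128 d z) :=
      (Complex.mul_conj _).symm
    rw [show (((128 : ℕ) : ℂ) * z + d) = w128 d z by simp [w128]]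
    push_cast
    rw [hnsq]
    field_simp
    ring
  have hs256 : Real.sqrt 256 = 16 := by
    rw [show (256 : ℝ) = 16 ^ 2 by norm_num, Real.sqrt_sq (by norm_num)]
  rw [key, cpow_half_ofReal_mul (by positivity), Real.sqrt_div' _ hn0.le, hs256]
  have hρ0 : (Real.sqrt (Complex.normSq (w128 d z)) : ℂ) ≠ 0 := by
    exact_mod_cast (Real.sqrt_pos.mpr hn0).ne'
  push_cast
  field_simp

end Constants

/-! ### The arithmetic identity -/

section Arith

variable (D : ℕ) [NeZero D]

/-- **The `z`-free identity** behind the level-`128` law (`D` odd square-free, `gcd(a, D) = 1`,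
`a a* ≡ 1 (mod 8D)`): `4096 √2 √D · 𝒦₃₂(a, a*) = i · G(a; 128)³ · N²`, `N = 128 D`. [folklore] -/
theorem evalConst32_key (hodd : Odd D) {a a' : ℤ} (haD : a.gcd D = 1) (ha : Odd a)
    (h8 : (a : ZMod 8) * (a' : ZMod 8) = 1) (hDm : ((a * a' : ℤ) : ZMod D) = 1) :
    4096 * (Real.sqrt 2 : ℂ) * (Real.sqrt D : ℂ) * evalConst32 D a a' =
      I * quadGaussSum 128 a 0 ^ 3 * ((128 * D : ℕ) : ℂ) ^ 2 := by
  have hs2sq : ((Real.sqrt 2 : ℂ)) ^ 2 = 2 := by exact_mod_cast Real.sq_sqrt (by norm_num : (0:ℝ) ≤ 2)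
  have hD0 : (0 : ℝ) < D := by exact_mod_cast Nat.pos_of_ne_zero (NeZero.ne D)
  have hsDsq : ((Real.sqrt D : ℂ)) ^ 2 = D := by exact_mod_cast Real.sq_sqrt hD0.le
  have I_sq : I ^ 2 = -1 := Complex.I_sq
  -- `a mod 8`
  obtain ⟨r, hr⟩ : ∃ r : ℤ, a % 8 = r := ⟨_, rfl⟩
  have ha8 : a = 8 * (a / 8) + r := by omega
  have hcases : r = 1 ∨ r = 3 ∨ r = 5 ∨ r = 7 := by
    have := Int.odd_iff.mp ha; omega
  have e8 : (a : ZMod 8) = (r : ZMod 8) := by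
    rw [ha8]; push_cast; rw [show (8 : ZMod 8) = 0 from rfl, zero_mul, zero_add]
  have e4 : (a : ZMod 4) = (r : ZMod 4) := by
    rw [ha8]; push_cast; rw [show (8 : ZMod 4) = 0 from rfl, zero_mul, zero_add]
  -- `a* ≡ a (mod 8)`
  have ha'8 : (a' : ZMod 8) = (r : ZMod 8) := by
    rw [e8] at h8
    have hrr : (r : ZMod 8) * (r : ZMod 8) = 1 := by
      rcases hcases with rfl | rfl | rfl | rfl <;> decide
    calc (a' : ZMod 8) = (r : ZMod 8) * ((r : ZMod 8) * (a' : ZMod 8)) := by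
          rw [← mul_assoc, hrr, one_mul]
      _ = r := by rw [h8, mul_one]
  have hneg8 : ((-a' : ℤ) : ZMod 8) = -(r : ZMod 8) := by push_cast; rw [ha'8]
  have hneg4 : ((-a' : ℤ) : ZMod 4) = -(r : ZMod 4) := by
    have := congrArg (ZMod.castHom (show 4 ∣ 8 by norm_num) (ZMod 4)) ha'8
    rw [map_intCast, map_intCast] at this
    push_cast; rw [this]
  -- the two-adic factor
  have htwo : twoFac D (-a') = ((ZMod.χ₈ (-(r : ZMod 8)) *
      (if D % 4 = 1 then (ZMod.χ₄ (-(r : ZMod 4)) : ℤ) else 1) : ℤ) : ℂ) := by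
    unfold twoFac
    rw [show (ZMod.χ₈ ((-a' : ℤ) : ZMod 8)) = ZMod.χ₈ (-(r : ZMod 8)) by rw [hneg8],
      show (ZMod.χ₄ ((-a' : ℤ) : ZMod 4)) = ZMod.χ₄ (-(r : ZMod 4)) by rw [hneg4]]
  -- the Jacobi symbols
  have hJJ : ((jacobiSym (-a') D : ℤ) : ℂ) * jacobiSym a D =
      if D % 4 = 1 then 1 else -1 := by
    rcases Nat.odd_mod_four_iff.mp (Nat.odd_iff.mp hodd) with h1 | h3
    · rw [if_pos h1]; exact_mod_cast jacobi_prod_eq_one D h1 hDm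
    · rw [if_neg (by omega)]; exact_mod_cast jacobi_prod_eq_neg_one h3 hDm
  -- Gauss's sign
  have hG1 : quadGaussSum D 1 0 = if D % 4 = 1 then (Real.sqrt D : ℂ) else I * Real.sqrt D := by
    rcases Nat.odd_mod_four_iff.mp (Nat.odd_iff.mp hodd) with h1 | h3
    · rw [if_pos h1]; exact quadGaussSum_one_of_mod_four_eq_one h1
    · rw [if_neg (by omega)]; exact quadGaussSum_one_of_mod_four_eq_three h3
  -- `ψ₄(Da)`
  have hDa : (((D : ℤ) * a : ℤ) : ZMod 4) = (if D % 4 = 1 then (r : ZMod 4) else 3 * (r : ZMod 4)) := by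
    have hD4 : ((D : ℤ) : ZMod 4) = ((D % 4 : ℕ) : ZMod 4) := by
      rw [Int.cast_natCast, ← ZMod.natCast_mod D 4]
    push_cast
    rw [e4]
    rcases Nat.odd_mod_four_iff.mp (Nat.odd_iff.mp hodd) with h1 | h3
    · rw [if_pos h1, show ((D : ℕ) : ZMod 4) = 1 by rw [← ZMod.natCast_mod D 4, h1]; rfl, one_mul]
    · rw [if_neg (by omega), show ((D : ℕ) : ZMod 4) = 3 by rw [← ZMod.natCast_mod D 4, h3]; rfl]
  unfold evalConst32
  rw [quadGaussSum_32_mul D hodd haD, quadGaussSum_128_of_odd ha, htwo, hDa, hG1, e8, e4]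
  rcases Nat.odd_mod_four_iff.mp (Nat.odd_iff.mp hodd) with h1 | h3
  · simp only [if_pos h1] at hJJ ⊢
    rcases hcases with rfl | rfl | rfl | rfl
    · simp only [Int.cast_one]
      rw [show ZMod.χ₈ (-1 : ZMod 8) = 1 by decide, show ZMod.χ₄ (-1 : ZMod 4) = -1 by decide, show ZMod.χ₈ (1 : ZMod 8) = 1 by decide, stdAddChar_four_one]
      push_cast
      linear_combination (33554432 * (-1) * (Real.sqrt 2 : ℂ) * (1 + (I)) * 1 * (D : ℂ) * (Real.sqrt D : ℂ) ^ 2) * hJJ + (1 * 33554432 * (-1) * (Real.sqrt 2 : ℂ) * (1 + (I)) * 1 * (D : ℂ)) * hsDsq + (-(8388608 : ℂ) * I * 1 * (1 + (I)) ^ 3 * (D : ℂ) ^ 2 * (Real.sqrt 2 : ℂ)) * hs2sq + (-(16777216 : ℂ) * 1 * (Real.sqrt 2 : ℂ) * (D : ℂ) ^ 2 * (1 + (I)) * (2 * 1 + I)) * I_sq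
    · simp only [Int.cast_ofNat]
      rw [show ZMod.χ₈ (-3 : ZMod 8) = -1 by decide, show ZMod.χ₄ (-3 : ZMod 4) = 1 by decide, show ZMod.χ₈ (3 : ZMod 8) = -1 by decide, stdAddChar_four_three]
      push_cast
      linear_combination (33554432 * (-1) * (Real.sqrt 2 : ℂ) * (1 + (-I)) * 1 * (D : ℂ) * (Real.sqrt D : ℂ) ^ 2) * hJJ + (1 * 33554432 * (-1) * (Real.sqrt 2 : ℂ) * (1 + (-I)) * 1 * (D : ℂ)) * hsDsq + (-(8388608 : ℂ) * I * (-1) * (1 + (-I)) ^ 3 * (D : ℂ) ^ 2 * (Real.sqrt 2 : ℂ)) * hs2sq + (-(16777216 : ℂ) * (-1) * (Real.sqrt 2 : ℂ) * (D : ℂ) ^ 2 * (1 + (-I)) * (2 * (-1) + I)) * I_sq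
    · simp only [Int.cast_ofNat]
      rw [show ZMod.χ₈ (-5 : ZMod 8) = -1 by decide, show ZMod.χ₄ (-5 : ZMod 4) = -1 by decide, show ZMod.χ₈ (5 : ZMod 8) = -1 by decide, show (5 : ZMod 4) = 1 by decide, stdAddChar_four_one]
      push_cast
      linear_combination (33554432 * 1 * (Real.sqrt 2 : ℂ) * (1 + (I)) * 1 * (D : ℂ) * (Real.sqrt D : ℂ) ^ 2) * hJJ + (1 * 33554432 * 1 * (Real.sqrt 2 : ℂ) * (1 + (I)) * 1 * (D : ℂ)) * hsDsq + (-(8388608 : ℂ) * I * (-1) * (1 + (I)) ^ 3 * (D : ℂ) ^ 2 * (Real.sqrt 2 : ℂ)) * hs2sq + (-(16777216 : ℂ) * (-1) * (Real.sqrt 2 : ℂ) * (D : ℂ) ^ 2 * (1 + (I)) * (2 * 1 + I)) * I_sq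
    · simp only [Int.cast_ofNat]
      rw [show ZMod.χ₈ (-7 : ZMod 8) = 1 by decide, show ZMod.χ₄ (-7 : ZMod 4) = 1 by decide, show ZMod.χ₈ (7 : ZMod 8) = 1 by decide, show (7 : ZMod 4) = 3 by decide, stdAddChar_four_three]
      push_cast
      linear_combination (33554432 * 1 * (Real.sqrt 2 : ℂ) * (1 + (-I)) * 1 * (D : ℂ) * (Real.sqrt D : ℂ) ^ 2) * hJJ + (1 * 33554432 * 1 * (Real.sqrt 2 : ℂ) * (1 + (-I)) * 1 * (D : ℂ)) * hsDsq + (-(8388608 : ℂ) * I * 1 * (1 + (-I)) ^ 3 * (D : ℂ) ^ 2 * (Real.sqrt 2 : ℂ)) * hs2sq + (-(16777216 : ℂ) * 1 * (Real.sqrt 2 : ℂ) * (D : ℂ) ^ 2 * (1 + (-I)) * (2 * (-1) + I)) * I_sq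
  · have h3' : ¬ (D % 4 = 1) := by omega
    simp only [if_neg h3'] at hJJ ⊢
    rcases hcases with rfl | rfl | rfl | rfl
    · simp only [Int.cast_one]
      rw [show ZMod.χ₈ (-1 : ZMod 8) = 1 by decide, show ZMod.χ₈ (1 : ZMod 8) = 1 by decide, show (3 * 1 : ZMod 4) = 3 by decide, stdAddChar_four_three, stdAddChar_four_one]
      push_cast
      linear_combination (33554432 * 1 * (Real.sqrt 2 : ℂ) * (1 + (-I)) * I * (D : ℂ) * (Real.sqrt D : ℂ) ^ 2) * hJJ + ((-1) * 33554432 * 1 * (Real.sqrt 2 : ℂ) * (1 + (-I)) * I * (D : ℂ)) * hsDsq + (-(8388608 : ℂ) * I * 1 * (1 + (I)) ^ 3 * (D : ℂ) ^ 2 * (Real.sqrt 2 : ℂ)) * hs2sq + (-(16777216 : ℂ) * I * 1 * (Real.sqrt 2 : ℂ) * (D : ℂ) ^ 2 * (3 + 1 * I)) * I_sq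
    · simp only [Int.cast_ofNat]
      rw [show ZMod.χ₈ (-3 : ZMod 8) = -1 by decide, show ZMod.χ₈ (3 : ZMod 8) = -1 by decide, show (3 * 3 : ZMod 4) = 1 by decide, stdAddChar_four_one, stdAddChar_four_three]
      push_cast
      linear_combination (33554432 * (-1) * (Real.sqrt 2 : ℂ) * (1 + (I)) * I * (D : ℂ) * (Real.sqrt D : ℂ) ^ 2) * hJJ + ((-1) * 33554432 * (-1) * (Real.sqrt 2 : ℂ) * (1 + (I)) * I * (D : ℂ)) * hsDsq + (-(8388608 : ℂ) * I * (-1) * (1 + (-I)) ^ 3 * (D : ℂ) ^ 2 * (Real.sqrt 2 : ℂ)) * hs2sq + (-(16777216 : ℂ) * I * (-1) * (Real.sqrt 2 : ℂ) * (D : ℂ) ^ 2 * (3 + (-1) * I)) * I_sq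
    · simp only [Int.cast_ofNat]
      rw [show ZMod.χ₈ (-5 : ZMod 8) = -1 by decide, show ZMod.χ₈ (5 : ZMod 8) = -1 by decide, show (3 * 5 : ZMod 4) = 3 by decide, stdAddChar_four_three, show (5 : ZMod 4) = 1 by decide, stdAddChar_four_one]
      push_cast
      linear_combination (33554432 * (-1) * (Real.sqrt 2 : ℂ) * (1 + (-I)) * I * (D : ℂ) * (Real.sqrt D : ℂ) ^ 2) * hJJ + ((-1) * 33554432 * (-1) * (Real.sqrt 2 : ℂ) * (1 + (-I)) * I * (D : ℂ)) * hsDsq + (-(8388608 : ℂ) * I * (-1) * (1 + (I)) ^ 3 * (D : ℂ) ^ 2 * (Real.sqrt 2 : ℂ)) * hs2sq + (-(16777216 : ℂ) * I * (-1) * (Real.sqrt 2 : ℂ) * (D : ℂ) ^ 2 * (3 + 1 * I)) * I_sq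
    · simp only [Int.cast_ofNat]
      rw [show ZMod.χ₈ (-7 : ZMod 8) = 1 by decide, show ZMod.χ₈ (7 : ZMod 8) = 1 by decide, show (3 * 7 : ZMod 4) = 1 by decide, stdAddChar_four_one, show (7 : ZMod 4) = 3 by decide, stdAddChar_four_three]
      push_cast
      linear_combination (33554432 * 1 * (Real.sqrt 2 : ℂ) * (1 + (I)) * I * (D : ℂ) * (Real.sqrt D : ℂ) ^ 2) * hJJ + ((-1) * 33554432 * 1 * (Real.sqrt 2 : ℂ) * (1 + (I)) * I * (D : ℂ)) * hsDsq + (-(8388608 : ℂ) * I * 1 * (1 + (-I)) ^ 3 * (D : ℂ) ^ 2 * (Real.sqrt 2 : ℂ)) * hs2sq + (-(16777216 : ℂ) * I * 1 * (Real.sqrt 2 : ℂ) * (D : ℂ) ^ 2 * (3 + (-1) * I)) * I_sq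

/-- **The constant identity at `σ = (a b; 128 d)`** (`D` odd square-free, `gcd(a, D) = 1`,
`a a* ≡ 1 (mod 8D)`): the constant produced by the Poisson step equals the cube of the
`θ`-multiplier — for BOTH residues of `D` modulo `4` (trivial character). [folklore] -/
theorem const_identity128 (hodd : Odd D) {a a' d : ℤ} (haD : a.gcd D = 1) (ha : Odd a)
    (h8 : (a : ZMod 8) * (a' : ZMod 8) = 1) (hDm : ((a * a' : ℤ) : ZMod D) = 1) (z : ℍ) :
    (Real.sqrt (z.im / Complex.normSq (w128 d z)) : ℂ) *
        ((((2048 * ((128 * D : ℕ) : ℝ) ^ 3)⁻¹ : ℝ) : ℂ) * kappa (invFour (auxW32 (128 * D) 128 d z)) *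
          (((64 * (128 * D : ℕ) : ℝ) : ℂ))⁻¹) *
        (evalConst32 D a a' * ((Real.sqrt z.im : ℂ))⁻¹) =
      (1 / (2 * I * ((128 : ℕ) : ℂ) / (((128 : ℕ) : ℂ) * z + d)) ^ (1 / 2 : ℂ) *
        quadGaussSum 128 a 0) ^ 3 := by
  -- atoms
  have hw0 := w128_ne_zero d z
  have hn0 : (0 : ℝ) < Complex.normSq (w128 d z) := Complex.normSq_pos.mpr hw0
  set ρ : ℝ := Real.sqrt (Complex.normSq (w128 d z)) with hρ
  have hρ0 : 0 < ρ := Real.sqrt_pos.mpr hn0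
  set β : ℂ := (I * conj (w128 d z)) ^ (1 / 2 : ℂ) with hβdef
  have hβ : β ≠ 0 := beta128_ne_zero d z
  set sD : ℝ := Real.sqrt D with hsD
  have hD0 : (0 : ℝ) < D := by exact_mod_cast Nat.pos_of_ne_zero (NeZero.ne D)
  have hsD0 : 0 < sD := Real.sqrt_pos.mpr hD0
  set sy : ℝ := Real.sqrt z.im with hsy
  have hsy0 : 0 < sy := Real.sqrt_pos.mpr z.im_pos
  have hs2 : (0 : ℝ) < Real.sqrt 2 := Real.sqrt_pos.mpr (by norm_num)
  have hs2sq : ((Real.sqrt 2 : ℂ)) ^ 2 = 2 := by exact_mod_cast Real.sq_sqrt (by norm_num : (0:ℝ) ≤ 2)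
  -- the pieces
  have hκ := kappa_Z'128_mul D d z
  have hsM : Real.sqrt (128 * (128 * D : ℕ)) = 128 * sD := by
    rw [show ((128 * (128 * D : ℕ) : ℝ)) = 128 ^ 2 * D by push_cast; ring,
      Real.sqrt_mul (by norm_num), Real.sqrt_sq (by norm_num)]
  rw [hsM] at hκ
  have hκ' : kappa (invFour (auxW32 (128 * D) 128 d z)) =
      -(((128 * (128 * D : ℕ) : ℝ) : ℂ)) ^ 2 * ((128 * sD : ℝ) : ℂ) * w128 d z *
        (Complex.normSq (w128 d z) : ℂ) / (8 * (Real.sqrt 2 : ℂ) * β) := by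
    rw [eq_div_iff (by
      refine mul_ne_zero (mul_ne_zero (by norm_num) ?_) hβ
      exact_mod_cast hs2.ne')]
    exact hκ
  have him : Real.sqrt (z.im / Complex.normSq (w128 d z)) = sy / ρ := by
    rw [Real.sqrt_div' _ hn0.le]
  have hnsq : ((Complex.normSq (w128 d z) : ℝ) : ℂ) = (ρ : ℂ) ^ 2 := by
    rw [hρ]; exact_mod_cast (Real.sq_sqrt (Complex.normSq_nonneg _)).symm
  have hR := rho128_sq_eq d z
  rw [← hρ, ← hβdef] at hR
  -- the arithmetic identity, solved for `𝒦₃₂`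
  have key := evalConst32_key D hodd haD ha h8 hDm
  rw [← hsD] at key
  have hsD0' : (sD : ℂ) ≠ 0 := by exact_mod_cast hsD0.ne'
  have hE : evalConst32 D a a' = (Real.sqrt 2 : ℂ) * I * quadGaussSum 128 a 0 ^ 3 *
      ((128 * D : ℕ) : ℂ) ^ 2 / (8192 * sD) := by
    rw [eq_div_iff (mul_ne_zero (by norm_num) hsD0')]
    linear_combination (Real.sqrt 2 : ℂ) * key + (-4096 * (sD : ℂ) * evalConst32 D a a') * hs2sq
  rw [him, hκ', hE, thetaFactor_sigma128, hnsq, ← hρ, ← hβdef]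
  have hρ0' : (ρ : ℂ) ≠ 0 := by exact_mod_cast hρ0.ne'
  have hsy0' : (sy : ℂ) ≠ 0 := by exact_mod_cast hsy0.ne'
  have hs20 : (Real.sqrt 2 : ℂ) ≠ 0 := by exact_mod_cast hs2.ne'
  have hD0' : (D : ℂ) ≠ 0 := by exact_mod_cast hD0.ne'
  push_cast
  field_simp
  linear_combination (-(8589934592 : ℂ) * quadGaussSum 128 a 0 ^ 3) * hR

end Arith

/-! ### The laws and the assembly on `Γ₀(128)` -/

section Assembly

variable (D : ℕ) [NeZero D]

open CongruenceSubgroup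

/-- **The `σ`-law**: `K₃₂,D(w, σz) θ(z)³ = θ(σz)³ K₃₂,D(w, z)` for `σ = (a b; 128 d)` with
`gcd(a, D) = 1` (`D` odd square-free). [cite: Shintani1975, Prop. 1.6] -/
theorem kerD32_sigma_law (hsq : Squarefree D) (hodd : Odd D) (σ : SL(2, ℤ))
    (hc : (σ 1 0 : ℤ) = 128) (haD : (σ 0 0 : ℤ).gcd D = 1) (w z : ℍ) :
    kerD32 D w (σ • z) * shimuraTheta z ^ 3 = shimuraTheta (σ • z) ^ 3 * kerD32 D w z := by
  have hdet := det_eq_one' σ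
  rw [hc] at hdet
  have ha : Odd (σ 0 0 : ℤ) := by
    by_contra h
    rw [Int.not_odd_iff_even] at h
    obtain ⟨k, hk⟩ := h
    rw [hk] at hdet
    have : (2 : ℤ) ∣ 1 := ⟨k * σ 1 1 - σ 0 1 * 64, by linear_combination (-1 : ℤ) * hdet⟩
    omega
  have hcopZ : IsCoprime (σ 0 0 : ℤ) ((128 * D : ℕ) : ℤ) := by
    have h2 : IsCoprime (σ 0 0 : ℤ) 2 := by
      obtain ⟨k, hk⟩ := ha
      exact ⟨1, -k, by rw [hk]; ring⟩
    have h128 : IsCoprime (σ 0 0 : ℤ) ((2 : ℤ) ^ 7) := h2.pow_right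
    have hD : IsCoprime (σ 0 0 : ℤ) (D : ℤ) := Int.isCoprime_iff_gcd_eq_one.mpr haD
    have := h128.mul_right hD
    push_cast
    norm_num at this
    exact this
  have hunit : IsUnit ((σ 0 0 : ℤ) : ZMod (128 * D)) := by
    rw [ZMod.coe_int_isUnit_iff_isCoprime]; exact hcopZ.symm
  obtain ⟨u, hu⟩ := hunit
  set a' : ℤ := (((u⁻¹ : (ZMod (128 * D))ˣ) : ZMod (128 * D)).val : ℤ) with ha'
  have haa' : ((σ 0 0 : ℤ) : ZMod (128 * D)) * (a' : ZMod (128 * D)) = 1 := by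
    rw [ha', Int.cast_natCast, ZMod.natCast_zmod_val, ← hu, Units.mul_inv]
  have h8 : ((σ 0 0 : ℤ) : ZMod 8) * (a' : ZMod 8) = 1 := by
    have := congrArg (ZMod.castHom (show 8 ∣ 128 * D from dvd_mul_of_dvd_left (by norm_num) D)
      (ZMod 8)) haa'
    rw [map_mul, map_one, map_intCast, map_intCast] at this
    exact this
  have hDm : (((σ 0 0 : ℤ) * a' : ℤ) : ZMod D) = 1 := by
    have := congrArg (ZMod.castHom (dvd_mul_left D 128) (ZMod D)) haa'
    rw [map_mul, map_one, map_intCast, map_intCast] at this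
    push_cast
    exact this
  haveI : NeZero (128 : ℕ) := ⟨by norm_num⟩
  have hK := kerD32_smul_sigma D hsq hodd σ hc a' haa' w z
  have hθ : shimuraTheta (σ • z) =
      1 / (2 * I * ((128 : ℕ) : ℂ) / (((128 : ℕ) : ℂ) * z + (σ 1 1 : ℤ))) ^ (1 / 2 : ℂ) *
        quadGaussSum 128 (σ 0 0 : ℤ) 0 * shimuraTheta z := by
    rw [← thetaMul_one_eq_shimuraTheta, ← thetaMul_one_eq_shimuraTheta]
    exact thetaMul_one_smul hc (by norm_num) z
  have him : (σ • z).im = z.im / Complex.normSq (w128 (σ 1 1) z) := by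
    rw [ModularGroup.im_smul_eq_div_normSq, ModularGroup.denom_apply]
    congr 2
    rw [w128, hc]
    push_cast
    ring
  have hstar := const_identity128 D hodd (d := σ 1 1) haD ha h8 hDm z
  rw [hK, hθ, him]
  linear_combination (kerD32 D w z * shimuraTheta z ^ 3) * hstar

open Literature.NumberTheory.LFunctions.Fourier (summable_one_add_norm_rpow_neg) in
omit [NeZero D] in
/-- **Continuity of the generalized kernels `𝒦₃₂` in `z`** (dominated convergence on `Im z > y₀`).
[folklore] -/
theorem continuous_genKernel32 {c : (Fin 3 → ℤ) → ℂ} (hc : BddWeight c) (t : ℝ) (ht : 0 < t) (w : ℍ) :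
    Continuous fun z : ℍ ↦ genKernel32 c t ht w z := by
  have hsqrt : Continuous fun z : ℍ ↦ ((Real.sqrt z.im : ℝ) : ℂ) :=
    Complex.continuous_ofReal.comp (Real.continuous_sqrt.comp UpperHalfPlane.continuous_im)
  suffices hS : Continuous fun z : ℍ ↦ ∑' k : Fin 3 → ℤ, c k * shintaniFn w (mulPos t ht z) (latSharp32 k) by
    unfold genKernel32; exact hsqrt.mul hS
  rw [continuous_iff_continuousAt]
  intro z₀
  set y : ℝ := z₀.im / 2 with hy
  have hy0 : 0 < y := by have := z₀.im_pos; positivity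
  set z₁ : ℍ := ⟨(y : ℂ) * I, by simpa using hy0⟩ with hz₁
  have hz₁im : z₁.im = y := by simp [hz₁, UpperHalfPlane.im]
  set U : Set ℍ := {z : ℍ | y < z.im} with hU
  have hUo : IsOpen U := isOpen_lt continuous_const UpperHalfPlane.continuous_im
  have hz₀U : z₀ ∈ U := by simp only [hU, Set.mem_setOf_eq, hy]; linarith [z₀.im_pos]
  obtain ⟨C', hC'⟩ := norm_term_le32 hc w (mulPos t ht z₁)
  have hbound : ∀ (k : Fin 3 → ℤ) (z : ℍ), z ∈ U →
      ‖c k * shintaniFn w (mulPos t ht z) (latSharp32 k)‖ ≤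
        ‖c k * shintaniFn w (mulPos t ht z₁) (latSharp32 k)‖ := by
    intro k z hz
    rw [norm_mul, norm_mul, norm_shintaniFn, norm_shintaniFn, im_mulPos, im_mulPos, hz₁im]
    refine mul_le_mul_of_nonneg_left (mul_le_mul_of_nonneg_left ?_ (norm_nonneg _)) (norm_nonneg _)
    apply Real.exp_le_exp.mpr
    have hm := majorant_nonneg w (latSharp32 k)
    have hz' : y ≤ z.im := le_of_lt hz
    have : t * y * majorant w (latSharp32 k) ≤ t * z.im * majorant w (latSharp32 k) := by
      apply mul_le_mul_of_nonneg_right _ hm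
      exact mul_le_mul_of_nonneg_left hz' ht.le
    linarith [Real.pi_pos, mul_le_mul_of_nonneg_left this (by positivity : (0:ℝ) ≤ 2 * π)]
  have hsum : Summable fun k : Fin 3 → ℤ ↦ ‖c k * shintaniFn w (mulPos t ht z₁) (latSharp32 k)‖ :=
    Summable.of_nonneg_of_le (fun _ ↦ norm_nonneg _) hC'
      ((summable_one_add_norm_rpow_neg (ι := Fin 3) (b := 4) (by norm_num)).mul_left C')
  have hcont : ContinuousOn (fun z : ℍ ↦ ∑' k : Fin 3 → ℤ, c k * shintaniFn w (mulPos t ht z) (latSharp32 k)) U := by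
    refine continuousOn_tsum (fun k ↦ ?_) hsum (fun k z hz ↦ hbound k z hz)
    exact (continuous_const.mul (continuous_shintaniFn_mulPos w t ht _)).continuousOn
  exact hcont.continuousAt (hUo.mem_nhds hz₀U)

/-- Continuity of `z ↦ K₃₂,D(w, z)`. [folklore] -/
theorem continuous_kerD32 (w : ℍ) : Continuous fun z : ℍ ↦ kerD32 D w z :=
  continuous_genKernel32 (bddWeight_cD32 D) _ _ w

/-- The generating set used: `T`, `-1`, and the `σ = (a b; 128 d)` with `gcd(a, D) = 1`. [folklore] -/
def genSet32D : Set SL(2, ℤ) :=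
  {ModularGroup.T} ∪ {-1} ∪ {σ | (σ 1 0 : ℤ) = 128 ∧ (σ 0 0 : ℤ).gcd D = 1}

omit [NeZero D] in
/-- `Γ₀(128) ≤ ⟨genSet32D⟩` (`D` odd): shift `a` by a multiple of `128` into a class prime to `D`.
[folklore] -/
theorem gamma0_le_closure_genSet32D (hodd : Odd D) :
    (Gamma0 128 : Set SL(2, ℤ)) ⊆ Subgroup.closure (genSet32D D) := by
  intro γ hγ
  have h1 : γ ∈ Subgroup.closure (gamma0GenSet 128) := by
    have := gamma0_le_closure_genSet 7 (by norm_num)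
    norm_num at this
    exact this hγ
  have hsub : gamma0GenSet 128 ⊆ (Subgroup.closure (genSet32D D) : Set SL(2, ℤ)) := by
    intro σ hσ
    simp only [gamma0GenSet, Set.mem_union, Set.mem_singleton_iff, Set.mem_setOf_eq] at hσ
    rcases hσ with (rfl | rfl) | hσ
    · exact Subgroup.subset_closure (by simp [genSet32D])
    · exact Subgroup.subset_closure (by simp [genSet32D])
    · have hcop : IsCoprime (128 : ℤ) (D : ℤ) := by
        have h2 : IsCoprime (2 : ℤ) (D : ℤ) := by
          rw [Int.isCoprime_iff_gcd_eq_one]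
          have := Nat.coprime_two_left.mpr hodd
          exact_mod_cast this
        have := h2.pow_left (m := 7)
        norm_num at this
        exact this
      obtain ⟨u, v, huv⟩ := hcop
      set k : ℤ := u * (1 - σ 0 0) with hk
      have hcop' : ((σ 0 0 : ℤ) + k * 128).gcd D = 1 := by
        apply Int.isCoprime_iff_gcd_eq_one.mp
        refine ⟨1, (1 - σ 0 0) * v, ?_⟩
        rw [hk]
        linear_combination (1 - (σ 0 0 : ℤ)) * huv
      set σ' := ModularGroup.T ^ k * σ with hσ'
      have h10 : ((σ' 1 0 : ℤ)) = 128 := by rw [hσ', (T_zpow_mul_apply k σ).1, hσ]; rfl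
      have h00 : ((σ' 0 0 : ℤ)).gcd D = 1 := by
        rw [hσ', (T_zpow_mul_apply k σ).2]
        push_cast at hσ
        rw [hσ]
        exact hcop'
      have hmem : σ' ∈ Subgroup.closure (genSet32D D) :=
        Subgroup.subset_closure (Or.inr ⟨h10, h00⟩)
      have hT : ModularGroup.T ∈ Subgroup.closure (genSet32D D) :=
        Subgroup.subset_closure (by simp [genSet32D])
      have : σ = ModularGroup.T ^ (-k) * σ' := by rw [hσ', ← mul_assoc, ← _root_.zpow_add]; simp
      rw [this]
      exact mul_mem (zpow_mem hT _) hmem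
  exact ((Subgroup.closure_le _).mpr hsub) h1

/-- **Automorphy of the level-`32` twisted Shintani kernel**: for `D` odd and square-free
(either residue modulo `4`), `z ↦ K₃₂,D(w, z)` satisfies the `θ`-multiplier law of weight `3/2`
on `Γ₀(128)` with TRIVIAL character. [cite: Shintani1975, Prop. 1.6] -/
theorem isThetaAutomorphic_kerD32 (hsq : Squarefree D) (hodd : Odd D) (w : ℍ) :
    IsThetaAutomorphic 3 128 1 (fun z ↦ kerD32 D w z) := by
  have hχ : ∀ {x : ZMod 128}, IsUnit x → (1 : DirichletCharacter ℂ 128) x = 1 :=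
    fun hx ↦ MulChar.one_apply hx
  refine isThetaAutomorphic_of_generators (continuous_kerD32 D w) (genSet32D D) ?_
    (gamma0_le_closure_genSet32D D hodd) ?_
  · intro σ hσ
    simp only [genSet32D, Set.mem_union, Set.mem_singleton_iff, Set.mem_setOf_eq] at hσ
    simp only [SetLike.mem_coe, Gamma0_mem]
    rcases hσ with (rfl | rfl) | ⟨h10, _⟩
    · simp [ModularGroup.T]
    · simp
    · rw [h10]
      decide
  · intro σ hσ z
    simp only [genSet32D, Set.mem_union, Set.mem_singleton_iff, Set.mem_setOf_eq] at hσ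
    rcases hσ with (rfl | rfl) | ⟨h10, h00⟩
    · simp only
      rw [kerD32_T_smul hsq, shimuraTheta_T_smul]
      have : ((ModularGroup.T 1 1 : ℤ) : ZMod 128) = 1 := by simp [ModularGroup.T]
      rw [this, map_one]; ring
    · simp only
      rw [show ((-1 : SL(2, ℤ)) • z) = z from by rw [ModularGroup.SL_neg_smul, one_smul]]
      have : (((-1 : SL(2, ℤ)) 1 1 : ℤ) : ZMod 128) = -1 := by simp
      rw [this, hχ isUnit_one.neg]; ring
    · simp only
      have hdet := det_eq_one' σ
      rw [h10] at hdet
      have hd : IsUnit ((σ 1 1 : ℤ) : ZMod 128) := by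
        rw [ZMod.coe_int_isUnit_iff_isCoprime]
        refine ⟨-(σ 0 1 : ℤ), σ 0 0, ?_⟩
        push_cast
        linear_combination hdet
      rw [hχ hd, one_mul]
      exact kerD32_sigma_law D hsq hodd σ h10 h00 w z

end Assembly

end Literature.NumberTheory.EllipticCurves.Shintani
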